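import Summits.RiemannHypothesis.RiemannHypothesis.Theorems.LiAsymptoticModelFubini
import Summits.RiemannHypothesis.RiemannHypothesis.Theorems.LiAsymptoticDefs
import HarnessLib

/-!
# RiemannHypothesis / LiAsymptotic — crux K2 `LiSmoothMainTerm`, stub K2a: the MODEL INTEGRAL (RH-FREE)

RH-FREE [rh-li-prover].  Route `Theses/LiAsymptotic.lean` (rung L-P(P1⁺) «Li asymptotic law, quadratic range»,
cell `pub/rh-li`, theory memo `theory/TARGETS.md` §11.2 STEP 6 (6c)), item `LiSmoothMainTerm`
(stmt-RiemannHypothesis-19162), registered birth stub `stub_modelIntegral` (K2a) VERBATIM: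

  `(1/π) ∫_{(0,∞)} (1 − cos(n/t)) log(t/2π) dt = liMainTerm n = (n/2) log n + C₁ n`,  `n ≥ 1`,

`C₁ = liC1 = (γ − 1 − log 2π)/2`.  Proof: substitute `t = n/u` (`integral_comp_rpow_Ioi` with `p = −1`, then
`integral_comp_mul_left_Ioi`): the integral is `n ∫_0^∞ (1 − cos u) u⁻² (log(n/2π) − log u) du
= n (log(n/2π) J₀ − J₁)` with `J₀ = π/2`, `J₁ = (π/2)(1 − γ)` (part 2, `ModelIntegral.integral_one_sub_cos_div_sq`,
`ModelIntegral.integral_one_sub_cos_mul_log_div_sq`), i.e. `(nπ/2)(log n − log 2π − 1 + γ)`.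
Classical analysis; nothing here bears on the truth of RH.
-/

noncomputable section

-- D-0017: `Summit.<S>.<S>.…` is the designed namespace of a single-problem summit.
set_option linter.dupNamespace false

open MeasureTheory Set Filter Real
open scoped Topology

namespace Summit.RiemannHypothesis.RiemannHypothesis.Theorems.LiTheory

open Literature.NumberTheory.LFunctions

namespace ModelIntegral

/-- `(1 − cos u)/u²` is integrable on `(0, ∞)` (its integral is `π/2 ≠ 0`). -/
theorem integrableOn_one_sub_cos_div_sq : IntegrableOn (fun u : ℝ ↦ (1 - Real.cos u) / u ^ 2) (Ioi 0) := by
  refine Integrable.of_integral_ne_zero ?_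
  rw [integral_one_sub_cos_div_sq]; positivity

/-- `(1 − cos u) log u/u²` is integrable on `(0, ∞)` (its integral is `(π/2)(1 − γ) ≠ 0`). -/
theorem integrableOn_one_sub_cos_mul_log_div_sq :
    IntegrableOn (fun u : ℝ ↦ (1 - Real.cos u) * Real.log u / u ^ 2) (Ioi 0) := by
  refine Integrable.of_integral_ne_zero ?_
  rw [integral_one_sub_cos_mul_log_div_sq]
  have := Real.eulerMascheroniConstant_lt_two_thirds
  have : 0 < 1 - Real.eulerMascheroniConstant := by linarith
  positivity

/-- The substituted integrand: `∫_{(0,∞)} (1 − cos u)(log(n/2π) − log u)/u² du = (π/2)(log(n/2π) − 1 + γ)`. -/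
theorem integral_substituted {c : ℝ} :
    ∫ u in Ioi (0 : ℝ), (1 - Real.cos u) * (c - Real.log u) / u ^ 2 =
      π / 2 * (c - 1 + Real.eulerMascheroniConstant) := by
  have e : ∀ u : ℝ, (1 - Real.cos u) * (c - Real.log u) / u ^ 2 =
      c * ((1 - Real.cos u) / u ^ 2) - (1 - Real.cos u) * Real.log u / u ^ 2 := fun u ↦ by ring
  simp_rw [e]
  rw [integral_sub (integrableOn_one_sub_cos_div_sq.const_mul c) integrableOn_one_sub_cos_mul_log_div_sq,
    integral_const_mul, integral_one_sub_cos_div_sq, integral_one_sub_cos_mul_log_div_sq]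
  ring

/-- **The substitution `t = n/u`:** for `n ≥ 1`,
`∫_{(0,∞)} (1 − cos(n/t)) log(t/2π) dt = n ∫_{(0,∞)} (1 − cos u)(log(n/2π) − log u)/u² du`. -/
theorem integral_model_subst {n : ℕ} (hn : 1 ≤ n) :
    ∫ t in Ioi (0 : ℝ), (1 - Real.cos (n / t)) * Real.log (t / (2 * π)) =
      n * ∫ u in Ioi (0 : ℝ), (1 - Real.cos u) * (Real.log (n / (2 * π)) - Real.log u) / u ^ 2 := by
  have hn0 : (0 : ℝ) < n := by exact_mod_cast hn
  have hπ2 : (0 : ℝ) < 2 * π := by positivity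
  set G : ℝ → ℝ := fun t ↦ (1 - Real.cos (n / t)) * Real.log (t / (2 * π)) with hG
  -- step 1: `t ↦ 1/t`
  have h1 := integral_comp_rpow_Ioi G (p := -1) (by norm_num)
  set φ : ℝ → ℝ := fun x ↦ (x ^ 2)⁻¹ * ((1 - Real.cos (n * x)) * -Real.log (2 * π * x)) with hφ
  have h1' : ∫ x in Ioi (0 : ℝ), (|(-1 : ℝ)| * x ^ ((-1 : ℝ) - 1)) • G (x ^ (-1 : ℝ)) = ∫ x in Ioi (0 : ℝ), φ x := by
    refine setIntegral_congr_fun measurableSet_Ioi fun x hx ↦ ?_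
    have hx0 : 0 < x := mem_Ioi.1 hx
    simp only [hG, hφ, smul_eq_mul]
    rw [Real.rpow_neg_one, show ((-1 : ℝ) - 1) = -((2 : ℕ) : ℝ) by norm_num, Real.rpow_neg hx0.le,
      Real.rpow_natCast]
    have e1 : (n : ℝ) / x⁻¹ = n * x := by rw [div_eq_mul_inv, inv_inv]
    have e2 : Real.log (x⁻¹ / (2 * π)) = -Real.log (2 * π * x) := by
      rw [← Real.log_inv]; congr 1; field_simp
    rw [e1, e2]
    simp
  -- step 2: `x ↦ u/n`
  set ψ : ℝ → ℝ := fun u ↦ (n : ℝ) ^ 2 * ((1 - Real.cos u) * (Real.log (n / (2 * π)) - Real.log u) / u ^ 2) with hψ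
  have h2 := integral_comp_mul_left_Ioi ψ 0 hn0
  rw [mul_zero] at h2
  have h2' : ∫ x in Ioi (0 : ℝ), ψ (n * x) = ∫ x in Ioi (0 : ℝ), φ x := by
    refine setIntegral_congr_fun measurableSet_Ioi fun x hx ↦ ?_
    have hx0 : 0 < x := mem_Ioi.1 hx
    simp only [hψ, hφ]
    have e3 : Real.log (n / (2 * π)) - Real.log (n * x) = -Real.log (2 * π * x) := by
      rw [Real.log_div hn0.ne' hπ2.ne', Real.log_mul hn0.ne' hx0.ne', Real.log_mul hπ2.ne' hx0.ne']
      ring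
    rw [e3]
    field_simp
  -- assemble
  calc ∫ t in Ioi (0 : ℝ), G t = ∫ x in Ioi (0 : ℝ), φ x := by rw [← h1, h1']
    _ = ∫ x in Ioi (0 : ℝ), ψ (n * x) := h2'.symm
    _ = (n : ℝ)⁻¹ • ∫ u in Ioi (0 : ℝ), ψ u := h2
    _ = n * ∫ u in Ioi (0 : ℝ), (1 - Real.cos u) * (Real.log (n / (2 * π)) - Real.log u) / u ^ 2 := by
        simp only [hψ]
        rw [integral_const_mul, smul_eq_mul]
        field_simp

end ModelIntegral

open ModelIntegral in
/-- **Stub K2a `stub_modelIntegral` of crux `LiSmoothMainTerm`** (route `LiAsymptotic`, stmt-RiemannHypothesis-19162;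
RH-FREE; the classical-analysis heart of the rung): for `n ≥ 1`,
`(1/π) ∫_{(0,∞)} (1 − cos(n/t)) log(t/2π) dt = liMainTerm n = (n/2) log n + ((γ − 1 − log 2π)/2) n`.
Verbatim the registered signature `Sig.stub_modelIntegral`. -/
theorem liSmoothModelIntegral :
    ∀ (n : ℕ), 1 ≤ n →
      1 / Real.pi * (∫ t in Set.Ioi (0 : ℝ), (1 - Real.cos (n / t)) * Real.log (t / (2 * Real.pi))) =
        liMainTerm n := by
  intro n hn
  have hn0 : (0 : ℝ) < n := by exact_mod_cast hn
  have hπ := Real.pi_pos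
  rw [integral_model_subst hn, integral_substituted, liMainTerm, liC1,
    Real.log_div hn0.ne' (by positivity)]
  field_simp
  ring

end Summit.RiemannHypothesis.RiemannHypothesis.Theorems.LiTheory

end
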